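import Mathlib.NumberTheory.AbelSummation
import Mathlib.NumberTheory.Chebyshev
import Mathlib.NumberTheory.EulerProduct.Basic
import Mathlib.NumberTheory.Harmonic.Bounds
import Mathlib.Analysis.PSeries
import Mathlib.Analysis.SpecialFunctions.Integrals.Basic
import Literature.NumberTheory.Sieve.AsymptoticSieveForPrimesDecomposition
import HarnessLib

/-!
# Asymptotic sieve for primes: proofs of two elementary named facts of the decomposition

Trunk T-SIEVE. This file DISCHARGES two named facts of
`Literature.NumberTheory.Sieve.AsymptoticSieveForPrimesDecomposition`:
`Literature.NumberTheory.Sieve.fi_sieve_density_admissible` (FI §6 p. 1056: "Note that `g(p)h(p) < 1`, so the sieve theory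
applies"), from Chebyshev's bound `θ(x) ≤ x log 4` (Mathlib `Chebyshev.theta_le_log4_mul_x`) and
Abel summation (Mathlib `sum_mul_eq_sub_sub_integral_mul`); and `Literature.NumberTheory.Sieve.fi_densityConstant_pos`
(FI (1.13)–(1.14): `H > 0`), from the Euler product of `1/n` over smooth numbers (Mathlib
`EulerProduct.summable_and_hasSum_smoothNumbers_prod_primesBelow_geometric`), `log N ≤ H_{N-1}`
(Mathlib `log_add_one_le_harmonic`), `1 - a ≥ e^{-a/(1-a)}` and (1.8)–(1.9):

* `sum_primes_window_log_div_le`: for `2 ≤ u ≤ v`,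
  `∑_{u ≤ p < v} log p / p ≤ log 4 · log(v/u) + log 4 · (1 + log 2)` (Mertens–Chebyshev window
  bound: Abel summation on `(u - 1, v]` with `f(t) = 1/t`, `θ(t)/t ≤ log 4`, and
  `∫_{u-1}^v θ(t) dt/t² ≤ log 4 · log(v/(u-1)) ≤ log 4 · (log 2 + log(v/u))`);
* `exists_density_le_of_lt_one`: (1.8) gives `g(p) ≤ G < 1` uniformly
  (`G = max(1/2, max_{p ≤ 2K'} g(p))`, `K' = max K 1`);
* `fi_sieve_density_admissible_holds`: `w_ε(p) ≤ (1 + G)/2 = 1 - 1/A₁` for `A₁ = 2/(1 - G)`,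
  `w_ε(p) ≤ 2 g(p) ≤ 2K'/p`, hence the window condition with `κ = 2K' log 4`,
  `A₂ = 2K' log 4 (1 + log 2)`;
* `log_le_prod_primesBelow_one_sub_inv_inv` (`log N ≤ ∏_{p < N} (1 - 1/p)⁻¹`),
  `exp_neg_div_le_one_sub`, and `fi_densityConstant_pos_holds`: for `M ≥ 2` the partial product
  `∏_{p ≤ M} (1 - g(p))/(1 - 1/p)` is at least `e^{-C₀}`,
  `C₀ = |c| + |K₉|/(log 2)^{10} + K'²/(1 - G)`, hence so is its limit `H`.

Source of the statement: J. Friedlander, H. Iwaniec, *Asymptotic sieve for primes*, Ann. of Math.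
148 (1998) [FriedlanderIwaniecASP1998], §6 p. 1056; the sieve axioms are those of Brun's sieve in
A. C. Cojocaru, M. R. Murty, *An Introduction to Sieve Methods and their Applications* (2005)
[CojocaruMurty2005], Thm 6.2.5 (2)–(3).
-/

noncomputable section

open Filter Finset MeasureTheory Set
open scoped Chebyshev

namespace Literature.NumberTheory.Sieve

/-- **Mertens–Chebyshev window bound.** For `2 ≤ u ≤ v`,
`∑_{u ≤ p < v} log p / p ≤ log 4 · log(v/u) + log 4 · (1 + log 2)`, from `θ(t) ≤ t log 4` by Abel
summation on `(u - 1, v]`. [folklore] -/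
theorem sum_primes_window_log_div_le {u v : ℝ} (hu : 2 ≤ u) (huv : u ≤ v) :
    ∑ p ∈ (Nat.primesBelow ⌈v⌉₊).filter (fun p : ℕ => u ≤ (p : ℝ)), Real.log p / p ≤
      Real.log 4 * Real.log (v / u) + Real.log 4 * (1 + Real.log 2) := by
  classical
  set a : ℝ := u - 1 with ha_def
  set c : ℕ → ℝ := fun k => if k.Prime then Real.log k else 0 with hc_def
  have ha1 : 1 ≤ a := by rw [ha_def]; linarith
  have ha0 : 0 ≤ a := by linarith
  have hapos : 0 < a := by linarith
  have hab : a ≤ v := by rw [ha_def]; linarith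
  have hv0 : 0 < v := by linarith
  have hu0 : 0 < u := by linarith
  have hl4 : 0 < Real.log 4 := Real.log_pos (by norm_num)
  -- Step 1: the prime sum is dominated by `∑_{a < k ≤ v} k⁻¹ c(k)`
  have hle : ∑ p ∈ (Nat.primesBelow ⌈v⌉₊).filter (fun p : ℕ => u ≤ (p : ℝ)), Real.log p / p ≤
      ∑ k ∈ Ioc ⌊a⌋₊ ⌊v⌋₊, (k : ℝ)⁻¹ * c k := by
    have h1 : ∀ p ∈ (Nat.primesBelow ⌈v⌉₊).filter (fun p : ℕ => u ≤ (p : ℝ)),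
        Real.log p / p = (p : ℝ)⁻¹ * c p := by
      intro p hp
      have hpp := Nat.prime_of_mem_primesBelow (Finset.mem_filter.mp hp).1
      simp only [hc_def, if_pos hpp]
      ring
    rw [Finset.sum_congr rfl h1]
    refine Finset.sum_le_sum_of_subset_of_nonneg (fun p hp => ?_) (fun k _ _ => ?_)
    · obtain ⟨hp1, hp2⟩ := Finset.mem_filter.mp hp
      have hpv : (p : ℝ) < v := Nat.lt_ceil.mp (Nat.lt_of_mem_primesBelow hp1)
      refine Finset.mem_Ioc.mpr ⟨?_, ?_⟩
      · rw [Nat.floor_lt ha0]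
        rw [ha_def]; linarith
      · exact Nat.le_floor hpv.le
    · refine mul_nonneg (inv_nonneg.mpr (Nat.cast_nonneg _)) ?_
      simp only [hc_def]
      split_ifs with hk
      · exact Real.log_nonneg (by exact_mod_cast hk.one_lt.le)
      · exact le_rfl
  refine hle.trans ?_
  -- Step 2: Abel summation with `f(t) = t⁻¹`
  have hθ : ∀ t : ℝ, ∑ k ∈ Icc 0 ⌊t⌋₊, c k = θ t := fun t => by
    rw [Chebyshev.theta_eq_sum_Icc, Finset.sum_filter]
  have hdiff : ∀ t ∈ Set.Icc a v, DifferentiableAt ℝ (fun t : ℝ => t⁻¹) t := fun t ht =>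
    (hasDerivAt_inv (hapos.trans_le ht.1).ne').differentiableAt
  have hcont : ContinuousOn (fun t : ℝ => -(t ^ 2)⁻¹) (Set.Icc a v) := by
    refine ContinuousOn.neg (ContinuousOn.inv₀ (by fun_prop) fun t ht => ?_)
    exact pow_ne_zero 2 (hapos.trans_le ht.1).ne'
  have hint : IntegrableOn (deriv fun t : ℝ => t⁻¹) (Set.Icc a v) := by
    rw [deriv_inv']
    exact hcont.integrableOn_Icc
  have habel := sum_mul_eq_sub_sub_integral_mul c ha0 hab hdiff hint
  rw [habel]
  simp only [hθ, deriv_inv]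
  -- Step 3: the three terms
  have hT1 : v⁻¹ * θ v ≤ Real.log 4 := by
    rw [inv_mul_le_iff₀ hv0]
    have := Chebyshev.theta_le_log4_mul_x hv0.le
    linarith
  have hT2 : 0 ≤ a⁻¹ * θ a := mul_nonneg (inv_nonneg.mpr ha0) (Chebyshev.theta_nonneg a)
  have hT3 : -∫ t in Set.Ioc a v, -(t ^ 2)⁻¹ * θ t ≤ Real.log 4 * (Real.log 2 + Real.log (v / u)) := by
    rw [← integral_neg]
    have hIθ : IntegrableOn (fun t : ℝ => -(t ^ 2)⁻¹ * θ t) (Set.Ioc a v) := by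
      have := integrableOn_mul_sum_Icc c (m := 0) ha0 hcont.integrableOn_Icc (b := v)
      simp only [hθ] at this
      exact this.mono_set Set.Ioc_subset_Icc_self
    have hIinv : IntegrableOn (fun t : ℝ => Real.log 4 * t⁻¹) (Set.Ioc a v) := by
      refine (ContinuousOn.integrableOn_Icc ?_).mono_set Set.Ioc_subset_Icc_self
      refine ContinuousOn.mul continuousOn_const (ContinuousOn.inv₀ continuousOn_id fun t ht => ?_)
      exact (hapos.trans_le ht.1).ne'
    calc ∫ t in Set.Ioc a v, -(-(t ^ 2)⁻¹ * θ t)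
        ≤ ∫ t in Set.Ioc a v, Real.log 4 * t⁻¹ := by
          refine setIntegral_mono_on hIθ.neg hIinv measurableSet_Ioc fun t ht => ?_
          have ht0 : 0 < t := hapos.trans ht.1
          have hθt := Chebyshev.theta_le_log4_mul_x ht0.le
          rw [neg_mul, neg_neg, ← div_eq_inv_mul, div_le_iff₀ (by positivity)]
          calc θ t ≤ Real.log 4 * t := hθt
            _ = Real.log 4 * t⁻¹ * t ^ 2 := by field_simp
      _ = Real.log 4 * Real.log (v / a) := by
          rw [← intervalIntegral.integral_of_le hab, intervalIntegral.integral_const_mul,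
            integral_inv (Set.notMem_uIcc_of_lt hapos hv0)]
      _ ≤ Real.log 4 * (Real.log 2 + Real.log (v / u)) := by
          refine mul_le_mul_of_nonneg_left ?_ hl4.le
          rw [← Real.log_mul (by norm_num) (by positivity)]
          refine Real.log_le_log (by positivity) ?_
          rw [div_le_iff₀ hapos, ha_def]
          have : 2 * (v / u) * (u - 1) = 2 * v * ((u - 1) / u) := by ring
          rw [this]
          have h1 : 1 / 2 ≤ (u - 1) / u := by
            rw [div_le_div_iff₀ (by norm_num) hu0]; linarith
          nlinarith
  have := add_le_add (add_le_add hT1 (neg_nonpos.mpr hT2)) hT3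
  linarith [this]

/-- Under (1.8) the density is uniformly bounded away from `1`: `g(p) ≤ G < 1` for all primes,
with `G ≥ 1/2` (take `G = max(1/2, max_{p ≤ 2K'} g(p))`, `K' = max K 1`). [folklore] -/
theorem exists_density_le_of_lt_one {g : ArithmeticFunction ℝ} {K : ℝ}
    (hK : ∀ p : ℕ, p.Prime → 0 ≤ g p ∧ g p < 1 ∧ g p ≤ K / p) :
    ∃ G : ℝ, G < 1 ∧ 1 / 2 ≤ G ∧ ∀ p : ℕ, p.Prime → g p ≤ G := by
  classical
  set K' : ℝ := max K 1 with hK'def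
  have hK'1 : 1 ≤ K' := le_max_right _ _
  have hgK' : ∀ p : ℕ, p.Prime → g p ≤ K' / p := fun p hp =>
    (hK p hp).2.2.trans (div_le_div_of_nonneg_right (le_max_left _ _) (Nat.cast_nonneg _))
  have hlarge : ∀ p : ℕ, p.Prime → 2 * K' < p → g p ≤ 1 / 2 := by
    intro p hp h2
    have hp0 : (0 : ℝ) < p := by exact_mod_cast hp.pos
    refine (hgK' p hp).trans ?_
    rw [div_le_iff₀ hp0]
    linarith
  set S := Nat.primesLE ⌊2 * K'⌋₊ with hS
  by_cases hSn : S.Nonempty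
  · obtain ⟨p₀, hp₀, hmax⟩ := Finset.exists_max_image S (fun p => g p) hSn
    have hp₀p := Nat.prime_of_mem_primesLE hp₀
    refine ⟨max (1 / 2) (g p₀), max_lt (by norm_num) (hK p₀ hp₀p).2.1, le_max_left _ _,
      fun p hp => ?_⟩
    by_cases hp2 : (p : ℝ) ≤ 2 * K'
    · have hpS : p ∈ S := Nat.mem_primesLE.mpr ⟨Nat.le_floor hp2, hp⟩
      exact (hmax p hpS).trans (le_max_right _ _)
    · exact (hlarge p hp (lt_of_not_ge hp2)).trans (le_max_left _ _)
  · refine ⟨1 / 2, by norm_num, le_rfl, fun p hp => hlarge p hp ?_⟩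
    by_contra h2
    exact hSn ⟨p, Nat.mem_primesLE.mpr ⟨Nat.le_floor (le_of_not_gt h2), hp⟩⟩

/-- **Discharge of `fi_sieve_density_admissible`** (FI §6 p. 1056: "`g(p)h(p) < 1`, so the sieve
theory applies"): under (1.8), FI's densities `w_ε(p) = g(p)(1 + p^{-ε})(1 + g(p)p^{-ε})⁻¹`,
`0 < ε ≤ 1`, satisfy the hypotheses (2)–(3) of Brun's sieve (Cojocaru–Murty Thm 6.2.5) with
`A₁ = 2/(1 - G)`, `G = max(1/2, max_{p ≤ 2K'} g(p)) < 1`, `κ = 2K' log 4`,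
`A₂ = 2K' log 4 (1 + log 2)`, `K' = max K 1`. [cite: FriedlanderIwaniecASP1998, §6 p. 1056] -/
theorem fi_sieve_density_admissible_holds : fi_sieve_density_admissible := by
  intro g _ hK
  obtain ⟨K, hK⟩ := hK
  classical
  set K' : ℝ := max K 1 with hK'def
  have hK'1 : 1 ≤ K' := le_max_right _ _
  have hK'0 : 0 < K' := by linarith
  have hgK' : ∀ p : ℕ, p.Prime → g p ≤ K' / p := fun p hp =>
    (hK p hp).2.2.trans (div_le_div_of_nonneg_right (le_max_left _ _) (Nat.cast_nonneg _))
  have hg0 : ∀ p : ℕ, p.Prime → 0 ≤ g p := fun p hp => (hK p hp).1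
  obtain ⟨G, hG1, hG12, hGp⟩ := exists_density_le_of_lt_one hK
  refine ⟨2 * K' * Real.log 4, 2 / (1 - G), 2 * K' * (Real.log 4 * (1 + Real.log 2)),
    by positivity, ?_, fun ε hε hε1 => ⟨fun p hp => ?_, fun u v hu huv => ?_⟩⟩
  · rw [le_div_iff₀ (by linarith)]
    linarith
  · -- `0 ≤ w ≤ (1 + G)/2 = 1 - 1/A₁`
    have hp1 : (1 : ℝ) < p := by exact_mod_cast hp.one_lt
    have hp0 : (0 : ℝ) < p := by linarith
    set t : ℝ := (p : ℝ) ^ (-ε) with ht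
    have ht0 : 0 < t := Real.rpow_pos_of_pos hp0 _
    have ht1 : t ≤ 1 := Real.rpow_le_one_of_one_le_of_nonpos hp1.le (by linarith)
    have hg := hg0 p hp
    have hgG := hGp p hp
    have hden : 0 < 1 + g p * t := by positivity
    unfold fiSieveDensity
    rw [← ht]
    refine ⟨div_nonneg (by positivity) hden.le, ?_⟩
    rw [div_le_iff₀ hden, one_div_div]
    -- `g(1+t) ≤ (1 - (1-G)/2)(1 + g t)`
    have h1 : g p * t * (1 - G) ≤ g p * (1 - G) := by
      have : 0 ≤ g p * (1 - G) := by nlinarith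
      nlinarith
    nlinarith [mul_nonneg hg (sub_nonneg.mpr ht1), sq_nonneg (1 - G)]
  · -- the window condition
    have hterm : ∀ p ∈ (Nat.primesBelow ⌈v⌉₊).filter (fun p : ℕ => u ≤ (p : ℝ)),
        fiSieveDensity g ε p * Real.log p ≤ 2 * K' * (Real.log p / p) := by
      intro p hp
      have hpp := Nat.prime_of_mem_primesBelow (Finset.mem_filter.mp hp).1
      have hp1 : (1 : ℝ) < p := by exact_mod_cast hpp.one_lt
      have hp0 : (0 : ℝ) < p := by linarith
      have hlogp : 0 ≤ Real.log p := Real.log_nonneg hp1.le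
      set t : ℝ := (p : ℝ) ^ (-ε) with ht
      have ht0 : 0 < t := Real.rpow_pos_of_pos hp0 _
      have ht1 : t ≤ 1 := Real.rpow_le_one_of_one_le_of_nonpos hp1.le (by linarith)
      have hg := hg0 p hpp
      have hw2 : fiSieveDensity g ε p ≤ 2 * K' / p := by
        unfold fiSieveDensity
        rw [← ht]
        have hden : 1 ≤ 1 + g p * t := by nlinarith
        calc g p * (1 + t) / (1 + g p * t) ≤ g p * (1 + t) := div_le_self (by positivity) hden
          _ ≤ g p * 2 := by nlinarith
          _ ≤ K' / p * 2 := by gcongr; exact hgK' p hpp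
          _ = 2 * K' / p := by ring
      calc fiSieveDensity g ε p * Real.log p ≤ 2 * K' / p * Real.log p :=
            mul_le_mul_of_nonneg_right hw2 hlogp
        _ = 2 * K' * (Real.log p / p) := by ring
    calc ∑ p ∈ (Nat.primesBelow ⌈v⌉₊).filter (fun p : ℕ => u ≤ (p : ℝ)),
          fiSieveDensity g ε p * Real.log p
        ≤ ∑ p ∈ (Nat.primesBelow ⌈v⌉₊).filter (fun p : ℕ => u ≤ (p : ℝ)),
            2 * K' * (Real.log p / p) := Finset.sum_le_sum hterm
      _ = 2 * K' * ∑ p ∈ (Nat.primesBelow ⌈v⌉₊).filter (fun p : ℕ => u ≤ (p : ℝ)),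
            Real.log p / p := by rw [Finset.mul_sum]
      _ ≤ 2 * K' * (Real.log 4 * Real.log (v / u) + Real.log 4 * (1 + Real.log 2)) :=
          mul_le_mul_of_nonneg_left (sum_primes_window_log_div_le hu huv) (by positivity)
      _ = 2 * K' * Real.log 4 * Real.log (v / u) + 2 * K' * (Real.log 4 * (1 + Real.log 2)) := by
          ring

/-! ### `H > 0` -/

/-- `∏_{p < N} (1 - 1/p)⁻¹ ≥ log N`: the Euler product of `n ↦ 1/n` over the `N`-smooth numbers
(Mathlib `EulerProduct.summable_and_hasSum_smoothNumbers_prod_primesBelow_geometric`) dominates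
`∑_{n < N} 1/n = H_{N-1} ≥ log N`. [folklore] -/
theorem log_le_prod_primesBelow_one_sub_inv_inv (N : ℕ) :
    Real.log N ≤ ∏ p ∈ Nat.primesBelow N, (1 - (p : ℝ)⁻¹)⁻¹ := by
  classical
  rcases Nat.eq_zero_or_pos N with rfl | hN
  · simp
  let f : ℕ →* ℝ :=
    { toFun := fun n => (n : ℝ)⁻¹
      map_one' := by simp
      map_mul' := fun m n => by push_cast; exact mul_inv _ _ }
  have hf : ∀ {p : ℕ}, p.Prime → ‖f p‖ < 1 := by
    intro p hp
    have hp1 : (1 : ℝ) < p := by exact_mod_cast hp.one_lt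
    simp only [f, MonoidHom.coe_mk, OneHom.coe_mk, norm_inv, Real.norm_natCast]
    exact inv_lt_one_of_one_lt₀ hp1
  obtain ⟨-, hsum⟩ := EulerProduct.summable_and_hasSum_smoothNumbers_prod_primesBelow_geometric hf N
  -- the finite subfamily `{1, …, N-1}` of `N`-smooth numbers
  set s : Finset N.smoothNumbers := (Finset.Icc 1 (N - 1)).subtype (· ∈ N.smoothNumbers) with hs
  have hle : ∑ m ∈ s, f m ≤ ∏ p ∈ Nat.primesBelow N, (1 - f p)⁻¹ :=
    sum_le_hasSum s (fun m _ => inv_nonneg.mpr (Nat.cast_nonneg _)) hsum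
  have hsum_eq : ∑ m ∈ s, f m = ∑ m ∈ Finset.Icc 1 (N - 1), (m : ℝ)⁻¹ := by
    rw [hs, Finset.sum_subtype_eq_sum_filter, Finset.filter_true_of_mem]
    · rfl
    · intro m hm
      obtain ⟨h1, h2⟩ := Finset.mem_Icc.mp hm
      exact Nat.mem_smoothNumbers_of_lt h1 (by omega)
  have hharm : Real.log N ≤ ∑ m ∈ Finset.Icc 1 (N - 1), (m : ℝ)⁻¹ := by
    have h := log_add_one_le_harmonic (N - 1)
    rw [Nat.sub_add_cancel hN, harmonic_eq_sum_Icc] at h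
    push_cast at h
    exact h
  calc Real.log N ≤ ∑ m ∈ Finset.Icc 1 (N - 1), (m : ℝ)⁻¹ := hharm
    _ = ∑ m ∈ s, f m := hsum_eq.symm
    _ ≤ ∏ p ∈ Nat.primesBelow N, (1 - f p)⁻¹ := hle
    _ = ∏ p ∈ Nat.primesBelow N, (1 - (p : ℝ)⁻¹)⁻¹ := rfl

/-- `1 - a ≥ exp(-a/(1 - a))` for `0 ≤ a < 1` (from `1 - 1/y ≤ log y` at `y = 1 - a`). [folklore] -/
theorem exp_neg_div_le_one_sub {a : ℝ} (ha1 : a < 1) :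
    Real.exp (-(a / (1 - a))) ≤ 1 - a := by
  have h1a : 0 < 1 - a := by linarith
  have h := Real.one_sub_inv_le_log_of_pos h1a
  have heq : -(a / (1 - a)) = 1 - (1 - a)⁻¹ := by field_simp; ring
  rw [heq]
  calc Real.exp (1 - (1 - a)⁻¹) ≤ Real.exp (Real.log (1 - a)) := Real.exp_le_exp.mpr h
    _ = 1 - a := Real.exp_log h1a

/-- **Discharge of `fi_densityConstant_pos`** (FI (1.13)–(1.14): "`H` is the positive constant …
That this is positive follows since the series is also given by the infinite product"). Proof: for
`M ≥ 2`, `∏_{p ≤ M} (1 - g(p))/(1 - 1/p) ≥ exp(-∑_{p ≤ M} g(p)/(1 - g(p))) · log(M + 1)` by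
`1 - a ≥ e^{-a/(1-a)}` and `log_le_prod_primesBelow_one_sub_inv_inv`, and
`∑_{p ≤ M} g/(1 - g) ≤ ∑ g + ∑ g²/(1 - G) ≤ log log M + C` by (1.9), (1.8) and `∑ 1/p² ≤ 1`; hence
the partial products are `≥ e^{-C} > 0` and so is their limit `H`.
[cite: FriedlanderIwaniecASP1998, (1.13)-(1.14)] -/
theorem fi_densityConstant_pos_holds : fi_densityConstant_pos := by
  intro g _ hK h19 H hH
  obtain ⟨K, hK⟩ := hK
  obtain ⟨c, K₉, h19⟩ := h19
  classical
  set K' : ℝ := max K 1 with hK'def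
  have hK'1 : 1 ≤ K' := le_max_right _ _
  have hK'0 : 0 < K' := by linarith
  have hgK' : ∀ p : ℕ, p.Prime → g p ≤ K' / p := fun p hp =>
    (hK p hp).2.2.trans (div_le_div_of_nonneg_right (le_max_left _ _) (Nat.cast_nonneg _))
  have hg0 : ∀ p : ℕ, p.Prime → 0 ≤ g p := fun p hp => (hK p hp).1
  have hg1 : ∀ p : ℕ, p.Prime → g p < 1 := fun p hp => (hK p hp).2.1
  obtain ⟨G, hG1, -, hGp⟩ := exists_density_le_of_lt_one hK
  have h1G : 0 < 1 - G := by linarith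
  have hl2 : 0 < Real.log 2 := Real.log_pos one_lt_two
  -- the constant
  set C₀ : ℝ := |c| + |K₉| / Real.log 2 ^ 10 + K' ^ 2 / (1 - G) with hC₀
  -- lower bound for the partial products, `M ≥ 2`
  have hlow : ∀ M : ℕ, 2 ≤ M →
      Real.exp (-C₀) ≤ ∏ p ∈ Nat.primesLE M, (1 - g p) / (1 - (p : ℝ)⁻¹) := by
    intro M hM
    have hM1 : (1 : ℝ) < M := by exact_mod_cast hM
    have hM0 : (0 : ℝ) < M := by linarith
    have hlogM : 0 < Real.log M := Real.log_pos hM1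
    have hlogM2 : Real.log 2 ≤ Real.log M := Real.log_le_log two_pos (by exact_mod_cast hM)
    -- split the product
    rw [Finset.prod_div_distrib]
    have hB : Real.log M ≤ (∏ p ∈ Nat.primesLE M, (1 - (p : ℝ)⁻¹))⁻¹ := by
      rw [← Finset.prod_inv_distrib]
      have h := log_le_prod_primesBelow_one_sub_inv_inv (M + 1)
      rw [Nat.primesLE]
      refine le_trans (Real.log_le_log hM0 ?_) h
      push_cast; linarith
    have hBpos : 0 < ∏ p ∈ Nat.primesLE M, (1 - (p : ℝ)⁻¹) := by
      refine Finset.prod_pos fun p hp => ?_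
      have hp1 : (1 : ℝ) < p := by exact_mod_cast (Nat.prime_of_mem_primesLE hp).one_lt
      have : (p : ℝ)⁻¹ < 1 := inv_lt_one_of_one_lt₀ hp1
      linarith
    -- the numerator
    set T : ℝ := ∑ p ∈ Nat.primesLE M, g p / (1 - g p) with hT
    have hA : Real.exp (-T) ≤ ∏ p ∈ Nat.primesLE M, (1 - g p) := by
      rw [hT, ← Finset.sum_neg_distrib, Real.exp_sum]
      refine Finset.prod_le_prod (fun p _ => (Real.exp_pos _).le) fun p hp => ?_
      exact exp_neg_div_le_one_sub (hg1 p (Nat.prime_of_mem_primesLE hp))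
    -- bound for `T`
    have hsumg : ∑ p ∈ Nat.primesLE M, g p ≤ Real.log (Real.log M) + |c| + |K₉| / Real.log 2 ^ 10 := by
      have h := h19 M (by exact_mod_cast hM)
      rw [Nat.floor_natCast] at h
      have h' := (abs_le.mp h).2
      have hK9 : K₉ / Real.log (M : ℝ) ^ 10 ≤ |K₉| / Real.log 2 ^ 10 := by
        calc K₉ / Real.log (M : ℝ) ^ 10 ≤ |K₉| / Real.log (M : ℝ) ^ 10 :=
              div_le_div_of_nonneg_right (le_abs_self _) (by positivity)
          _ ≤ |K₉| / Real.log 2 ^ 10 := by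
              refine div_le_div_of_nonneg_left (abs_nonneg _) (by positivity) ?_
              gcongr
      linarith [le_abs_self c]
    have hsumg2 : ∑ p ∈ Nat.primesLE M, g p ^ 2 ≤ K' ^ 2 := by
      calc ∑ p ∈ Nat.primesLE M, g p ^ 2 ≤ ∑ p ∈ Nat.primesLE M, K' ^ 2 * ((p : ℝ) ^ 2)⁻¹ := by
            refine Finset.sum_le_sum fun p hp => ?_
            have hpp := Nat.prime_of_mem_primesLE hp
            have hp0 : (0 : ℝ) < p := by exact_mod_cast hpp.pos
            have h1 := hgK' p hpp
            have h0 := hg0 p hpp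
            calc g p ^ 2 ≤ (K' / p) ^ 2 := pow_le_pow_left₀ h0 h1 2
              _ = K' ^ 2 * ((p : ℝ) ^ 2)⁻¹ := by rw [div_pow]; ring
        _ = K' ^ 2 * ∑ p ∈ Nat.primesLE M, ((p : ℝ) ^ 2)⁻¹ := by rw [Finset.mul_sum]
        _ ≤ K' ^ 2 * ∑ i ∈ Finset.Ioo 1 (M + 1), ((i : ℝ) ^ 2)⁻¹ := by
            refine mul_le_mul_of_nonneg_left ?_ (sq_nonneg _)
            refine Finset.sum_le_sum_of_subset_of_nonneg (fun p hp => ?_) fun i _ _ => by positivity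
            obtain ⟨hpM, hpp⟩ := Nat.mem_primesLE.mp hp
            exact Finset.mem_Ioo.mpr ⟨hpp.one_lt, Nat.lt_succ_of_le hpM⟩
        _ ≤ K' ^ 2 * 1 := by
            refine mul_le_mul_of_nonneg_left ?_ (sq_nonneg _)
            have := sum_Ioo_inv_sq_le (α := ℝ) 1 (M + 1)
            norm_num at this
            exact this
        _ = K' ^ 2 := mul_one _
    have hTle : T ≤ Real.log (Real.log M) + C₀ := by
      have hsplit : T ≤ ∑ p ∈ Nat.primesLE M, g p + (∑ p ∈ Nat.primesLE M, g p ^ 2) / (1 - G) := by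
        rw [hT, Finset.sum_div, ← Finset.sum_add_distrib]
        refine Finset.sum_le_sum fun p hp => ?_
        have hpp := Nat.prime_of_mem_primesLE hp
        have h0 := hg0 p hpp
        have h1 := hg1 p hpp
        have hG' := hGp p hpp
        have h1g : 0 < 1 - g p := by linarith
        -- `g/(1-g) = g + g²/(1-g) ≤ g + g²/(1-G)`
        have : g p / (1 - g p) = g p + g p ^ 2 / (1 - g p) := by field_simp; ring
        rw [this]
        gcongr
      calc T ≤ _ := hsplit
        _ ≤ (Real.log (Real.log M) + |c| + |K₉| / Real.log 2 ^ 10) + K' ^ 2 / (1 - G) := by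
            gcongr
        _ = Real.log (Real.log M) + C₀ := by rw [hC₀]; ring
    -- combine
    have hexp : Real.exp (-C₀) ≤ Real.exp (-T) * Real.log M := by
      have : Real.exp (-(Real.log (Real.log M) + C₀)) ≤ Real.exp (-T) :=
        Real.exp_le_exp.mpr (by linarith)
      rw [neg_add, Real.exp_add, Real.exp_neg, Real.exp_log hlogM] at this
      calc Real.exp (-C₀) = (Real.log M)⁻¹ * Real.exp (-C₀) * Real.log M := by
            field_simp
        _ ≤ Real.exp (-T) * Real.log M := mul_le_mul_of_nonneg_right this hlogM.le
    calc Real.exp (-C₀) ≤ Real.exp (-T) * Real.log M := hexp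
      _ ≤ (∏ p ∈ Nat.primesLE M, (1 - g p)) * (∏ p ∈ Nat.primesLE M, (1 - (p : ℝ)⁻¹))⁻¹ :=
          mul_le_mul hA hB hlogM.le ((Real.exp_pos _).le.trans hA)
      _ = (∏ p ∈ Nat.primesLE M, (1 - g p)) / ∏ p ∈ Nat.primesLE M, (1 - (p : ℝ)⁻¹) := by
          rw [div_eq_mul_inv]
  -- pass to the limit
  have hHge : Real.exp (-C₀) ≤ H :=
    ge_of_tendsto hH (Filter.eventually_atTop.mpr ⟨2, hlow⟩)
  exact lt_of_lt_of_le (Real.exp_pos _) hHge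

end Literature.NumberTheory.Sieve
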